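import Summits.Ventures.LatticeQCDFlow.Scaling.DeathChainComparison
import Summits.Ventures.LatticeQCDFlow.Scaling.LumpedStarStepFloorSymmetric

/-!
HONEST FRAMING: exact (Metropolis-corrected) sampling algorithms for lattice gauge theory; figures
of merit are autocorrelation/cost numbers at stated couplings and volumes; no continuum-physics
claim.

# LumpedStarCollectorFloor — THE `log K` ON THE FLOOR SIDE OF THE LUMPED STAR'S STEP LAW: FROM THE COMPOSITION CROWDED AT `u`, THE NUMBER OF COLD `u`-PARTICLES CAN ONLY BE
# WORN DOWN ONE AT A TIME, BY AN ACCEPTED SWAP ONTO A `u`-PARTICLE (PROBABILITY `≤ σ·a·G/K` PER STEP), SO IT DOMINATES THE COUPON COLLECTOR OVER THE `K` COLD PARTICLES: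
# `d_S(n) ≥ 1 − s/(s−m)² − π{N(u) ≥ m}`, `s = K(1−σa/K)ⁿ`, AND `t_mix^{steps}(1/4) ≥ (K/(σa) − 1)·log(K/(3(E_π N(u) + 2)))` (lean-2 GEN-45, ours)

Venture-side (OURS).  Cell `lqcd-flow` (pub-lqcd), unit `pub-lqcd-lean-2-g45`, 2026-08-31.  Chapter AE, file 2 — file 1's comparison theorem instantiated on X5's step chain
`S = σA + (1−σ)B` of the lumped star (state = (hub content, composition) of `K+1` particles; `A` one swap attempt of the hub with a uniformly chosen cold particle, accepted with
`acc(h,v) = min{1, W_h/W_v}`; `B` the redraw of the hub particle from `μ_0`).  The statistic is the number of COLD `u`-particles `G(x) = N(u) − 𝟙{hub x = u}` (`= K − ψ` for chapter AD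
file 6's `ψ`): a redraw moves the hub particle and the hub together (`G` unchanged), a swap changes `G` by `±1` or `0`, and lowers it exactly when the hub (`≠ u`) is exchanged with a cold
`u`-particle — proposed with probability `N(u)/K = G/K` and accepted with probability `acc(hub,u) ≤ a` (`a = 1` always; `a = W₂/W_u` when `u` is the most persistent content).  So file 1
applies with `θ = σa/K` from the crowded state (`G = K`).

* `coldCount_le` (`G ≤ K`), `coldCount_cast`, `coldCount_redraw` (`B`-moves keep `G`), `coldCount_drop` (`S x y ≠ 0 ⇒ G x ≤ G y + 1`), `swap_onto_eq` (`Σ_{x'} A(x,x')𝟙{hub x' = u} =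
  (N(u)/K)·acc(hub x,u)` from a hub `≠ u`), `coldCount_redraw_filter` ∕ `coldCount_swap_filter` ∕ `coldCount_swap_down` (the pieces, reused at the scheme level in file 3),
  `coldCount_down` (`Σ_{y : G y + 1 = G x} S(x,y) ≤ (σa/K)·G(x)`),
  **`lumpedStar_step_worstTvDist_ge_collector`** (`d_S(n) ≥ 1 − s/(s−m)² − π{x : m ≤ N(u)}`, `s = K(1−σa/K)ⁿ`, `m < s`, any unit-mass `π ≥ 0`),
  **`lumpedStar_step_lt_mixingTime_collector`** (`K(1−σa/K)ⁿ ≥ 3(e+2)`, `E_π N(u) ≤ e`, `π` stationary ⇒ `n < t_mix(1/4)`),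
  **`lumpedStar_step_mixingTime_ge_collector`** (**`t_mix^{steps}(1/4) ≥ (K/(σa) − 1)·log(K/(3(e+2)))`**), and
  **`lumpedStar_step_mixingTime_ge_collector_piS`** — the same for X5's own stationary law `π_S`, with stationarity and convergence discharged (X5, X7, LPW Thm 4.9).

Reading (no numerics implied): against chapter AD file 4's ceiling `O((K/((1−σ)σp̄))·log(K/(σp̄ε)))` and file 6's budget floors `(K+1)/(8(1−σ))`, `(K−7)/(8σa)`, this is the
coupon-collector floor `Ω((K/(σa))·log(K/E_π N(u)))`: the logarithm is the full `log K` for a content `u` that is rare under `π_S` (`E_{π_S}N(u) = μ_0(u) + Kμ_1(u) = O(1)` —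
file 3 computes it at the scheme level), `½·log K` for `μ_1(u) ≲ K^{−1/2}`, and nothing for `μ_1(u)` of order one (there the `u`-count of the dislodged particles, thrown away
by the comparison, is what carries the logarithm — NOT CLAIMED).  Literature grade (cell rule): OWN, elementary on file 1 (Levin–Peres–Wilmer §7.3.1 mechanism); nothing
cited as a fact; no new bib keys.
-/

noncomputable section

open Finset Function
open Literature.Probability.MarkovChains

namespace Summit.Ventures.LatticeQCDFlow.Scaling

section CollectorFloor
variable {X : Type*} [Fintype X] [DecidableEq X] {S : Type*} [Fintype S] [DecidableEq S]
variable {hub : X → S} {comp : X → S → ℕ} {K : ℕ} {μ0 W : S → ℝ} {σ : ℝ} {acc : S → S → ℝ} {Kh : (S → ℕ) → S → S → ℝ}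
variable {Ast Bst Sst : X → X → ℝ} {g : (S → ℕ) → ℝ} {πS : X → ℝ} {Z : ℝ}

/-! ## §1 The cold `u`-count `G = N(u) − 𝟙{hub = u}` -/

omit [Fintype X] [DecidableEq X] in
/-- `G ≤ K`: the hub particle is present, so at most `K` particles are cold. [ours] -/
theorem coldCount_le (hhub : ∀ x, comp x (hub x) ≠ 0) (hsum : ∀ x, ∑ v, comp x v = K + 1) (u : S) (x : X) :
    comp x u - (if hub x = u then 1 else 0) ≤ K := by
  classical
  by_cases hx : hub x = u
  · rw [if_pos hx]
    have h := single_le_sum (f := fun v => comp x v) (fun v _ => Nat.zero_le _) (mem_univ u)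
    rw [hsum x] at h
    omega
  · rw [if_neg hx]
    have h1 : comp x u + comp x (hub x) ≤ K + 1 := by
      rw [← hsum x, ← Finset.sum_pair (Ne.symm hx)]
      exact Finset.sum_le_sum_of_subset_of_nonneg (subset_univ _) fun _ _ _ => Nat.zero_le _
    have h2 : 1 ≤ comp x (hub x) := Nat.one_le_iff_ne_zero.mpr (hhub x)
    omega

omit [Fintype X] [DecidableEq X] [Fintype S] in
/-- `(G : ℝ) = N(u) − 𝟙{hub = u}` (the hub content is present). [ours] -/
theorem coldCount_cast (hhub : ∀ x, comp x (hub x) ≠ 0) (u : S) (x : X) :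
    ((comp x u - (if hub x = u then 1 else 0) : ℕ) : ℝ) = (comp x u : ℝ) - (if hub x = u then (1 : ℝ) else 0) := by
  by_cases hx : hub x = u
  · rw [if_pos hx, if_pos hx]
    have h1 : 1 ≤ comp x u := by rw [← hx]; exact Nat.one_le_iff_ne_zero.mpr (hhub x)
    rw [Nat.cast_sub h1, Nat.cast_one]
  · rw [if_neg hx, if_neg hx]; simp

omit [Fintype X] [DecidableEq X] [Fintype S] in
/-- **A redraw keeps `G`:** `comp y + δ_{hub x} = comp x + δ_{hub y} ⇒ G y = G x` (the hub particle and the hub move together). [ours] -/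
theorem coldCount_redraw (hhub : ∀ x, comp x (hub x) ≠ 0) (u : S) {x y : X} (h : comp y + Pi.single (hub x) 1 = comp x + Pi.single (hub y) 1) :
    comp y u - (if hub y = u then 1 else 0) = comp x u - (if hub x = u then 1 else 0) := by
  have hu := congr_fun h u
  simp only [Pi.add_apply, Pi.single_apply] at hu
  have hx1 : hub x = u → 1 ≤ comp x u := fun e => by rw [← e]; exact Nat.one_le_iff_ne_zero.mpr (hhub x)
  have hy1 : hub y = u → 1 ≤ comp y u := fun e => by rw [← e]; exact Nat.one_le_iff_ne_zero.mpr (hhub y)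
  by_cases hx : hub x = u <;> by_cases hy : hub y = u
  · rw [if_pos hx, if_pos hy]; rw [if_pos hx.symm, if_pos hy.symm] at hu; omega
  · rw [if_pos hx, if_neg hy]; rw [if_pos hx.symm, if_neg (fun e => hy e.symm)] at hu; have := hx1 hx; omega
  · rw [if_neg hx, if_pos hy]; rw [if_neg (fun e => hx e.symm), if_pos hy.symm] at hu; have := hy1 hy; omega
  · rw [if_neg hx, if_neg hy]; rw [if_neg (fun e => hx e.symm), if_neg (fun e => hy e.symm)] at hu; omega

omit [Fintype X] [DecidableEq X] in
/-- **`G` drops by at most one per step:** `S(x,y) ≠ 0 ⇒ G x ≤ G y + 1` (a swap keeps the composition, a redraw keeps `G`). [ours] -/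
theorem coldCount_drop (hhub : ∀ x, comp x (hub x) ≠ 0)
    (hA : ∀ x x', Ast x x' = if comp x' = comp x then Kh (comp x) (hub x) (hub x') else 0)
    (hB : ∀ x x', Bst x x' = μ0 (hub x') * (if comp x' + Pi.single (hub x) 1 = comp x + Pi.single (hub x') 1 then 1 else 0))
    (hS : ∀ x x', Sst x x' = σ * Ast x x' + (1 - σ) * Bst x x') (u : S) (x y : X) (hxy : Sst x y ≠ 0) :
    comp x u - (if hub x = u then 1 else 0) ≤ comp y u - (if hub y = u then 1 else 0) + 1 := by
  by_cases hc : comp y = comp x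
  · rw [hc]
    have hy1 : hub y = u → 1 ≤ comp x u := fun e => by rw [← hc, ← e]; exact Nat.one_le_iff_ne_zero.mpr (hhub y)
    by_cases hx : hub x = u <;> by_cases hy : hub y = u
    · rw [if_pos hx, if_pos hy]; omega
    · rw [if_pos hx, if_neg hy]; omega
    · rw [if_neg hx, if_pos hy]; have := hy1 hy; omega
    · rw [if_neg hx, if_neg hy]; omega
  · by_cases hr : comp y + Pi.single (hub x) 1 = comp x + Pi.single (hub y) 1
    · rw [coldCount_redraw hhub u hr]; omega
    · exfalso; apply hxy
      rw [hS, hA, if_neg hc, hB, if_neg hr]; ring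

omit [DecidableEq X] in
/-- **From a hub `≠ u`, the swap moves the hub onto a `u`-particle with probability exactly `(N(u)/K)·acc(hub x, u)`.** [ours] -/
theorem swap_onto_eq (hinj : ∀ x x', hub x = hub x' → comp x = comp x' → x = x')
    (hsurj : ∀ (z : S) (N : S → ℕ), ∑ v, N v = K + 1 → N z ≠ 0 → ∃ x, hub x = z ∧ comp x = N) (hhub : ∀ x, comp x (hub x) ≠ 0)
    (hsum : ∀ x, ∑ v, comp x v = K + 1)
    (hKoff : ∀ N h v, h ≠ v → Kh N h v = if N h = 0 then 0 else (N v : ℝ) / K * acc h v)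
    (hA : ∀ x x', Ast x x' = if comp x' = comp x then Kh (comp x) (hub x) (hub x') else 0)
    (u : S) (x : X) (hx : hub x ≠ u) :
    ∑ x', Ast x x' * (if hub x' = u then (1 : ℝ) else 0) = (comp x u : ℝ) / K * acc (hub x) u := by
  classical
  have e : ∑ x', Ast x x' * (if hub x' = u then (1 : ℝ) else 0)
      = ∑ x', (if comp x' = comp x then (fun v => Kh (comp x) (hub x) v * (if v = u then (1 : ℝ) else 0)) (hub x') else 0) := by
    refine sum_congr rfl fun x' _ => ?_
    rw [hA]
    by_cases hc : comp x' = comp x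
    · rw [if_pos hc, if_pos hc]
    · rw [if_neg hc, if_neg hc, zero_mul]
  rw [e, star_sum_fiber hinj hsurj hhub (comp x) (hsum x) (fun v => Kh (comp x) (hub x) v * (if v = u then (1 : ℝ) else 0))]
  simp only [mul_ite, mul_one, mul_zero]
  rw [show (∑ v, if comp x v = 0 then (0 : ℝ) else if v = u then Kh (comp x) (hub x) v else 0) = ∑ v, (if v = u then (if comp x u = 0 then 0 else Kh (comp x) (hub x) u) else 0) from
    sum_congr rfl fun v _ => by by_cases hv : v = u <;> simp [hv], Finset.sum_ite_eq' univ u, if_pos (mem_univ _)]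
  by_cases hu0 : comp x u = 0
  · rw [if_pos hu0, hu0]; simp
  · rw [if_neg hu0, hKoff (comp x) (hub x) u hx, if_neg (hhub x)]

omit [Fintype X] [DecidableEq X] in
/-- On the event `{G y + 1 = G x}` the redraw part vanishes (a redraw keeps `G`). [ours] -/
theorem coldCount_redraw_filter (hhub : ∀ x, comp x (hub x) ≠ 0)
    (hB : ∀ x x', Bst x x' = μ0 (hub x') * (if comp x' + Pi.single (hub x) 1 = comp x + Pi.single (hub x') 1 then 1 else 0)) (u : S) (x y : X)
    (hf : comp y u - (if hub y = u then 1 else 0) + 1 = comp x u - (if hub x = u then 1 else 0)) : Bst x y = 0 := by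
  rw [hB]
  by_cases hr : comp y + Pi.single (hub x) 1 = comp x + Pi.single (hub y) 1
  · exfalso; have := coldCount_redraw hhub u hr; omega
  · rw [if_neg hr, mul_zero]

omit [Fintype X] [DecidableEq X] in
/-- On the event `{G y + 1 = G x}` the swap part lives on `{hub x ≠ u, hub y = u}`: `𝟙{G y + 1 = G x}·A(x,y) ≤ 𝟙{hub x ≠ u}·A(x,y)·𝟙{hub y = u}` (`A ≥ 0`). [ours] -/
theorem coldCount_swap_filter (hhub : ∀ x, comp x (hub x) ≠ 0)
    (hA : ∀ x x', Ast x x' = if comp x' = comp x then Kh (comp x) (hub x) (hub x') else 0) (hA0 : ∀ x x', 0 ≤ Ast x x') (u : S) (x y : X) :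
    (if comp y u - (if hub y = u then 1 else 0) + 1 = comp x u - (if hub x = u then 1 else 0) then Ast x y else 0)
      ≤ (if hub x = u then (0 : ℝ) else 1) * (Ast x y * (if hub y = u then (1 : ℝ) else 0)) := by
  by_cases hf : comp y u - (if hub y = u then 1 else 0) + 1 = comp x u - (if hub x = u then 1 else 0)
  · rw [if_pos hf]
    by_cases hc : comp y = comp x
    · -- then `hub y = u` and `hub x ≠ u`
      rw [hc] at hf
      have hy1 : hub y = u → 1 ≤ comp x u := fun e => by rw [← hc, ← e]; exact Nat.one_le_iff_ne_zero.mpr (hhub y)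
      have hyu : hub y = u := by
        by_contra hy
        rw [if_neg hy] at hf
        by_cases hx : hub x = u
        · rw [if_pos hx] at hf; omega
        · rw [if_neg hx] at hf; omega
      have hxu : hub x ≠ u := by
        intro hx; rw [if_pos hx, if_pos hyu] at hf; have := hy1 hyu; omega
      rw [if_neg hxu, if_pos hyu]; linarith
    · have hA0' : Ast x y = 0 := by rw [hA, if_neg hc]
      rw [hA0']
      exact mul_nonneg (by split_ifs <;> norm_num) (by simp)
  · rw [if_neg hf]
    exact mul_nonneg (by split_ifs <;> norm_num) (mul_nonneg (hA0 x y) (by split_ifs <;> norm_num))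

omit [DecidableEq X] in
/-- **The swap part of the down-probability:** `Σ_y 𝟙{hub x ≠ u}·A(x,y)·𝟙{hub y = u} ≤ (a/K)·G(x)` (`acc(·,u) ≤ a` off `u`). [ours] -/
theorem coldCount_swap_down (hinj : ∀ x x', hub x = hub x' → comp x = comp x' → x = x')
    (hsurj : ∀ (z : S) (N : S → ℕ), ∑ v, N v = K + 1 → N z ≠ 0 → ∃ x, hub x = z ∧ comp x = N) (hhub : ∀ x, comp x (hub x) ≠ 0)
    (hsum : ∀ x, ∑ v, comp x v = K + 1)
    (hKoff : ∀ N h v, h ≠ v → Kh N h v = if N h = 0 then 0 else (N v : ℝ) / K * acc h v)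
    (hA : ∀ x x', Ast x x' = if comp x' = comp x then Kh (comp x) (hub x) (hub x') else 0)
    (u : S) {a : ℝ} (ha0 : 0 ≤ a) (ha : ∀ h, h ≠ u → acc h u ≤ a) (x : X) :
    ∑ y, (if hub x = u then (0 : ℝ) else 1) * (Ast x y * (if hub y = u then (1 : ℝ) else 0))
      ≤ a / K * ((comp x u - (if hub x = u then 1 else 0) : ℕ) : ℝ) := by
  classical
  rw [← mul_sum]
  by_cases hx : hub x = u
  · rw [if_pos hx, zero_mul]
    exact mul_nonneg (div_nonneg ha0 (Nat.cast_nonneg _)) (Nat.cast_nonneg _)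
  · rw [if_neg hx, one_mul, swap_onto_eq hinj hsurj hhub hsum hKoff hA u x hx, if_neg hx, Nat.sub_zero]
    have hN0 : 0 ≤ (comp x u : ℝ) := Nat.cast_nonneg _
    have hK0 : 0 ≤ (K : ℝ) := Nat.cast_nonneg _
    have h1 : (comp x u : ℝ) / K * acc (hub x) u ≤ (comp x u : ℝ) / K * a := mul_le_mul_of_nonneg_left (ha (hub x) hx) (div_nonneg hN0 hK0)
    have e : a / K * (comp x u : ℝ) = (comp x u : ℝ) / K * a := by ring
    rw [e]; exact h1

omit [DecidableEq X] in
/-- **THE DOWN-PROBABILITY:** `Σ_{y : G y + 1 = G x} S(x,y) ≤ (σa/K)·G(x)` — only a swap from a hub `≠ u` onto a cold `u`-particle lowers `G`, with probability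
`σ·(N(u)/K)·acc(hub x,u) ≤ σ·(a/K)·G(x)` (`acc(·,u) ≤ a` off `u`). [ours] -/
theorem coldCount_down (hinj : ∀ x x', hub x = hub x' → comp x = comp x' → x = x')
    (hsurj : ∀ (z : S) (N : S → ℕ), ∑ v, N v = K + 1 → N z ≠ 0 → ∃ x, hub x = z ∧ comp x = N) (hhub : ∀ x, comp x (hub x) ≠ 0)
    (hsum : ∀ x, ∑ v, comp x v = K + 1)
    (hKoff : ∀ N h v, h ≠ v → Kh N h v = if N h = 0 then 0 else (N v : ℝ) / K * acc h v) (hσ0 : 0 ≤ σ)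
    (hA : ∀ x x', Ast x x' = if comp x' = comp x then Kh (comp x) (hub x) (hub x') else 0) (hA0 : ∀ x x', 0 ≤ Ast x x')
    (hB : ∀ x x', Bst x x' = μ0 (hub x') * (if comp x' + Pi.single (hub x) 1 = comp x + Pi.single (hub x') 1 then 1 else 0))
    (hS : ∀ x x', Sst x x' = σ * Ast x x' + (1 - σ) * Bst x x') (u : S) {a : ℝ} (ha0 : 0 ≤ a) (ha : ∀ h, h ≠ u → acc h u ≤ a) (x : X) :
    ∑ y ∈ univ.filter (fun y => comp y u - (if hub y = u then 1 else 0) + 1 = comp x u - (if hub x = u then 1 else 0)), Sst x y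
      ≤ σ * a / K * ((comp x u - (if hub x = u then 1 else 0) : ℕ) : ℝ) := by
  classical
  rw [Finset.sum_filter]
  have key : ∀ y, (if comp y u - (if hub y = u then 1 else 0) + 1 = comp x u - (if hub x = u then 1 else 0) then Sst x y else 0)
      ≤ σ * ((if hub x = u then (0 : ℝ) else 1) * (Ast x y * (if hub y = u then (1 : ℝ) else 0))) := by
    intro y
    have hsw := coldCount_swap_filter hhub hA hA0 u x y
    by_cases hf : comp y u - (if hub y = u then 1 else 0) + 1 = comp x u - (if hub x = u then 1 else 0)
    · rw [if_pos hf] at hsw ⊢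
      rw [hS, coldCount_redraw_filter hhub hB u x y hf, mul_zero, add_zero]
      exact mul_le_mul_of_nonneg_left hsw hσ0
    · rw [if_neg hf] at hsw ⊢
      exact mul_nonneg hσ0 hsw
  refine (sum_le_sum fun y _ => key y).trans ?_
  rw [← mul_sum]
  have h := coldCount_swap_down hinj hsurj hhub hsum hKoff hA u ha0 ha x
  have e : σ * a / K * (((comp x u - (if hub x = u then 1 else 0)) : ℕ) : ℝ) = σ * (a / K * (((comp x u - (if hub x = u then 1 else 0)) : ℕ) : ℝ)) := by ring
  rw [e]; exact mul_le_mul_of_nonneg_left h hσ0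

/-! ## §2 The floor -/

/-- **THE COUPON-COLLECTOR DISTANCE FLOOR FOR THE STEP CHAIN:** from the composition crowded at `u`, for every unit-mass `π ≥ 0`, every `n` and every `m < s`,
`s = K(1−σa/K)ⁿ` (`0 ≤ σ ≤ 1`, `0 ≤ a ≤ 1`, `acc(·,u) ≤ a` off `u`, `K ≥ 2`): **`d_S(n) ≥ 1 − s/(s−m)² − π{x : m ≤ N(u)}`**. [ours] -/
theorem lumpedStar_step_worstTvDist_ge_collector (hinj : ∀ x x', hub x = hub x' → comp x = comp x' → x = x')
    (hsurj : ∀ (z : S) (N : S → ℕ), ∑ v, N v = K + 1 → N z ≠ 0 → ∃ x, hub x = z ∧ comp x = N) (hhub : ∀ x, comp x (hub x) ≠ 0)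
    (hsum : ∀ x, ∑ v, comp x v = K + 1) (hK : 2 ≤ K)
    (hKoff : ∀ N h v, h ≠ v → Kh N h v = if N h = 0 then 0 else (N v : ℝ) / K * acc h v)
    (hμ0 : ∀ v, 0 ≤ μ0 v) (hσ0 : 0 ≤ σ) (hσ1 : σ ≤ 1)
    (hA : ∀ x x', Ast x x' = if comp x' = comp x then Kh (comp x) (hub x) (hub x') else 0) (hA0 : ∀ x x', 0 ≤ Ast x x') (hA1 : ∀ x, ∑ x', Ast x x' = 1)
    (hB : ∀ x x', Bst x x' = μ0 (hub x') * (if comp x' + Pi.single (hub x) 1 = comp x + Pi.single (hub x') 1 then 1 else 0)) (hB1 : ∀ x, ∑ x', Bst x x' = 1)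
    (hS : ∀ x x', Sst x x' = σ * Ast x x' + (1 - σ) * Bst x x') {π : X → ℝ} (hπ0 : ∀ x, 0 ≤ π x) (hπ1 : ∑ x, π x = 1)
    (u : S) {a : ℝ} (ha0 : 0 ≤ a) (ha1 : a ≤ 1) (ha : ∀ h, h ≠ u → acc h u ≤ a) (n : ℕ) {m : ℝ} (hms : m < (K : ℝ) * (1 - σ * a / K) ^ n) :
    1 - (K : ℝ) * (1 - σ * a / K) ^ n / ((K : ℝ) * (1 - σ * a / K) ^ n - m) ^ 2 - ∑ x ∈ univ.filter (fun x => m ≤ (comp x u : ℝ)), π x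
      ≤ worstTvDist Sst π n := by
  classical
  -- the crowded start, `G = K`
  obtain ⟨x₀, hx₀h, hx₀c⟩ := hsurj u (fun v => if v = u then K + 1 else 0) (by rw [Finset.sum_ite_eq' univ u]; simp) (by simp)
  have hG₀ : comp x₀ u - (if hub x₀ = u then 1 else 0) = K := by rw [hx₀c, if_pos hx₀h]; simp
  -- the death operator and the hypotheses of file 1
  obtain ⟨Q, hQ⟩ : ∃ Q : (ℕ → ℝ) → ℕ → ℝ, ∀ f j, Q f j = σ * a / K * j * f (j - 1) + (1 - σ * a / K * j) * f j := ⟨fun f j => _, fun _ _ => rfl⟩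
  have hKpos : (0 : ℝ) < K := by exact_mod_cast (by omega : 0 < K)
  have hθ0 : 0 ≤ σ * a / K := div_nonneg (mul_nonneg hσ0 ha0) hKpos.le
  have hσa1 : σ * a ≤ 1 := by nlinarith
  have hθK : σ * a / K * K ≤ 1 := by rw [div_mul_cancel₀ _ hKpos.ne']; exact hσa1
  have hθh : 2 * (σ * a / K) ≤ 1 := by
    rw [show 2 * (σ * a / K) = 2 * (σ * a) / K by ring, div_le_one hKpos]
    have : (2 : ℝ) ≤ K := by exact_mod_cast hK
    nlinarith
  have hB0 : ∀ x x', 0 ≤ Bst x x' := fun x x' => by rw [hB]; exact mul_nonneg (hμ0 _) (by split_ifs <;> norm_num)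
  have hSrs : IsRowStochastic Sst := by
    refine ⟨fun x y => by rw [hS]; exact add_nonneg (mul_nonneg hσ0 (hA0 x y)) (mul_nonneg (by linarith) (hB0 x y)), fun x => ?_⟩
    simp_rw [hS]; rw [sum_add_distrib, ← mul_sum, ← mul_sum, hA1, hB1]; ring
  have hGK : ∀ x, comp x u - (if hub x = u then 1 else 0) ≤ K := coldCount_le hhub hsum u
  have hdrop := coldCount_drop hhub hA hB hS u
  have hdown := coldCount_down hinj hsurj hhub hsum hKoff hσ0 hA hA0 hB hS u ha0 ha
  have hg : ∀ x, (((comp x u - (if hub x = u then 1 else 0)) : ℕ) : ℝ) ≤ (comp x u : ℝ) := fun x => by exact_mod_cast Nat.sub_le _ _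
  have hms' : m < (((comp x₀ u - (if hub x₀ = u then 1 else 0)) : ℕ) : ℝ) * (1 - σ * a / K) ^ n := by rw [hG₀]; exact hms
  have h := compare_worstTvDist_ge (G := fun x => comp x u - (if hub x = u then 1 else 0)) hQ hθ0 hθh hθK hSrs hGK hdrop hdown hg hπ0 hπ1 x₀ n hms'
  simp only [hG₀] at h
  exact h

/-- **BEFORE THE COUPON-COLLECTOR TIME THE STEP CHAIN IS FAR FROM `π`:** if `K(1−σa/K)ⁿ ≥ 3(e+2)` with `E_π N(u) ≤ e` (`π` a stationary probability vector, the chain `¼`-close at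
some time), then **`n < t_mix^{steps}(1/4)`**. [ours] -/
theorem lumpedStar_step_lt_mixingTime_collector (hinj : ∀ x x', hub x = hub x' → comp x = comp x' → x = x')
    (hsurj : ∀ (z : S) (N : S → ℕ), ∑ v, N v = K + 1 → N z ≠ 0 → ∃ x, hub x = z ∧ comp x = N) (hhub : ∀ x, comp x (hub x) ≠ 0)
    (hsum : ∀ x, ∑ v, comp x v = K + 1) (hK : 2 ≤ K)
    (hKoff : ∀ N h v, h ≠ v → Kh N h v = if N h = 0 then 0 else (N v : ℝ) / K * acc h v)
    (hμ0 : ∀ v, 0 ≤ μ0 v) (hσ0 : 0 ≤ σ) (hσ1 : σ ≤ 1)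
    (hA : ∀ x x', Ast x x' = if comp x' = comp x then Kh (comp x) (hub x) (hub x') else 0) (hA0 : ∀ x x', 0 ≤ Ast x x') (hA1 : ∀ x, ∑ x', Ast x x' = 1)
    (hB : ∀ x x', Bst x x' = μ0 (hub x') * (if comp x' + Pi.single (hub x) 1 = comp x + Pi.single (hub x') 1 then 1 else 0)) (hB1 : ∀ x, ∑ x', Bst x x' = 1)
    (hS : ∀ x x', Sst x x' = σ * Ast x x' + (1 - σ) * Bst x x') {π : X → ℝ} (hπ0 : ∀ x, 0 ≤ π x) (hπ1 : ∑ x, π x = 1) (hst : IsStationary π Sst)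
    (u : S) {a : ℝ} (ha0 : 0 ≤ a) (ha1 : a ≤ 1) (ha : ∀ h, h ≠ u → acc h u ≤ a) {e : ℝ} (he : ∑ x, π x * (comp x u : ℝ) ≤ e)
    (hmix : ∃ t₀, worstTvDist Sst π t₀ ≤ 1 / 4) {n : ℕ} (hn : 3 * (e + 2) ≤ (K : ℝ) * (1 - σ * a / K) ^ n) :
    n < mixingTime Sst π (1 / 4) := by
  classical
  obtain ⟨x₀, hx₀h, hx₀c⟩ := hsurj u (fun v => if v = u then K + 1 else 0) (by rw [Finset.sum_ite_eq' univ u]; simp) (by simp)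
  have hG₀ : comp x₀ u - (if hub x₀ = u then 1 else 0) = K := by rw [hx₀c, if_pos hx₀h]; simp
  obtain ⟨Q, hQ⟩ : ∃ Q : (ℕ → ℝ) → ℕ → ℝ, ∀ f j, Q f j = σ * a / K * j * f (j - 1) + (1 - σ * a / K * j) * f j := ⟨fun f j => _, fun _ _ => rfl⟩
  have hKpos : (0 : ℝ) < K := by exact_mod_cast (by omega : 0 < K)
  have hθ0 : 0 ≤ σ * a / K := div_nonneg (mul_nonneg hσ0 ha0) hKpos.le
  have hσa1 : σ * a ≤ 1 := by nlinarith
  have hθK : σ * a / K * K ≤ 1 := by rw [div_mul_cancel₀ _ hKpos.ne']; exact hσa1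
  have hθh : 2 * (σ * a / K) ≤ 1 := by
    rw [show 2 * (σ * a / K) = 2 * (σ * a) / K by ring, div_le_one hKpos]
    have : (2 : ℝ) ≤ K := by exact_mod_cast hK
    nlinarith
  have hB0 : ∀ x x', 0 ≤ Bst x x' := fun x x' => by rw [hB]; exact mul_nonneg (hμ0 _) (by split_ifs <;> norm_num)
  have hSrs : IsRowStochastic Sst := by
    refine ⟨fun x y => by rw [hS]; exact add_nonneg (mul_nonneg hσ0 (hA0 x y)) (mul_nonneg (by linarith) (hB0 x y)), fun x => ?_⟩
    simp_rw [hS]; rw [sum_add_distrib, ← mul_sum, ← mul_sum, hA1, hB1]; ring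
  have hGK : ∀ x, comp x u - (if hub x = u then 1 else 0) ≤ K := coldCount_le hhub hsum u
  have hdrop := coldCount_drop hhub hA hB hS u
  have hdown := coldCount_down hinj hsurj hhub hsum hKoff hσ0 hA hA0 hB hS u ha0 ha
  have hg : ∀ x, (((comp x u - (if hub x = u then 1 else 0)) : ℕ) : ℝ) ≤ (comp x u : ℝ) := fun x => by exact_mod_cast Nat.sub_le _ _
  have hn' : 3 * (e + 2) ≤ (((comp x₀ u - (if hub x₀ = u then 1 else 0)) : ℕ) : ℝ) * (1 - σ * a / K) ^ n := by rw [hG₀]; exact hn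
  exact compare_lt_mixingTime (G := fun x => comp x u - (if hub x = u then 1 else 0)) hQ hθ0 hθh hθK hSrs hGK hdrop hdown hg hπ0 hπ1 hst he hmix x₀ hn'

/-- **THE COUPON-COLLECTOR MIXING FLOOR OF THE LUMPED STAR'S STEP CHAIN, as printed:** `π` a stationary probability vector with `E_π N(u) ≤ e`, the chain `¼`-close at some time,
`0 < σa`, `σ ≤ 1`, `a ≤ 1`, `acc(·,u) ≤ a` off `u`, `K ≥ 2`: **`t_mix^{steps}(1/4) ≥ (K/(σa) − 1)·log(K/(3(e+2)))`**. [ours] -/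
theorem lumpedStar_step_mixingTime_ge_collector (hinj : ∀ x x', hub x = hub x' → comp x = comp x' → x = x')
    (hsurj : ∀ (z : S) (N : S → ℕ), ∑ v, N v = K + 1 → N z ≠ 0 → ∃ x, hub x = z ∧ comp x = N) (hhub : ∀ x, comp x (hub x) ≠ 0)
    (hsum : ∀ x, ∑ v, comp x v = K + 1) (hK : 2 ≤ K)
    (hKoff : ∀ N h v, h ≠ v → Kh N h v = if N h = 0 then 0 else (N v : ℝ) / K * acc h v)
    (hμ0 : ∀ v, 0 ≤ μ0 v) (hσ0 : 0 < σ) (hσ1 : σ ≤ 1)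
    (hA : ∀ x x', Ast x x' = if comp x' = comp x then Kh (comp x) (hub x) (hub x') else 0) (hA0 : ∀ x x', 0 ≤ Ast x x') (hA1 : ∀ x, ∑ x', Ast x x' = 1)
    (hB : ∀ x x', Bst x x' = μ0 (hub x') * (if comp x' + Pi.single (hub x) 1 = comp x + Pi.single (hub x') 1 then 1 else 0)) (hB1 : ∀ x, ∑ x', Bst x x' = 1)
    (hS : ∀ x x', Sst x x' = σ * Ast x x' + (1 - σ) * Bst x x') {π : X → ℝ} (hπ0 : ∀ x, 0 ≤ π x) (hπ1 : ∑ x, π x = 1) (hst : IsStationary π Sst)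
    (u : S) {a : ℝ} (ha0 : 0 < a) (ha1 : a ≤ 1) (ha : ∀ h, h ≠ u → acc h u ≤ a) {e : ℝ} (he : ∑ x, π x * (comp x u : ℝ) ≤ e)
    (hmix : ∃ t₀, worstTvDist Sst π t₀ ≤ 1 / 4) :
    ((K : ℝ) / (σ * a) - 1) * Real.log ((K : ℝ) / (3 * (e + 2))) ≤ (mixingTime Sst π (1 / 4) : ℝ) := by
  classical
  obtain ⟨x₀, hx₀h, hx₀c⟩ := hsurj u (fun v => if v = u then K + 1 else 0) (by rw [Finset.sum_ite_eq' univ u]; simp) (by simp)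
  have hG₀ : comp x₀ u - (if hub x₀ = u then 1 else 0) = K := by rw [hx₀c, if_pos hx₀h]; simp
  obtain ⟨Q, hQ⟩ : ∃ Q : (ℕ → ℝ) → ℕ → ℝ, ∀ f j, Q f j = σ * a / K * j * f (j - 1) + (1 - σ * a / K * j) * f j := ⟨fun f j => _, fun _ _ => rfl⟩
  have hKpos : (0 : ℝ) < K := by exact_mod_cast (by omega : 0 < K)
  have hσa0 : 0 < σ * a := mul_pos hσ0 ha0
  have hθ0 : 0 < σ * a / K := div_pos hσa0 hKpos
  have hσa1 : σ * a ≤ 1 := by nlinarith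
  have hθK : σ * a / K * K ≤ 1 := by rw [div_mul_cancel₀ _ hKpos.ne']; exact hσa1
  have hθh : 2 * (σ * a / K) ≤ 1 := by
    rw [show 2 * (σ * a / K) = 2 * (σ * a) / K by ring, div_le_one hKpos]
    have : (2 : ℝ) ≤ K := by exact_mod_cast hK
    nlinarith
  have hB0 : ∀ x x', 0 ≤ Bst x x' := fun x x' => by rw [hB]; exact mul_nonneg (hμ0 _) (by split_ifs <;> norm_num)
  have hSrs : IsRowStochastic Sst := by
    refine ⟨fun x y => by rw [hS]; exact add_nonneg (mul_nonneg hσ0.le (hA0 x y)) (mul_nonneg (by linarith) (hB0 x y)), fun x => ?_⟩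
    simp_rw [hS]; rw [sum_add_distrib, ← mul_sum, ← mul_sum, hA1, hB1]; ring
  have hGK : ∀ x, comp x u - (if hub x = u then 1 else 0) ≤ K := coldCount_le hhub hsum u
  have hdrop := coldCount_drop hhub hA hB hS u
  have hdown := coldCount_down hinj hsurj hhub hsum hKoff hσ0.le hA hA0 hB hS u ha0.le ha
  have hg : ∀ x, (((comp x u - (if hub x = u then 1 else 0)) : ℕ) : ℝ) ≤ (comp x u : ℝ) := fun x => by exact_mod_cast Nat.sub_le _ _
  have hx₀pos : 0 < comp x₀ u - (if hub x₀ = u then 1 else 0) := by rw [hG₀]; omega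
  have h := compare_mixingTime_ge (G := fun x => comp x u - (if hub x = u then 1 else 0)) hQ hθ0 hθh hθK hSrs hGK hdrop hdown hg hπ0 hπ1 hst he hmix x₀ hx₀pos
  simp only [hG₀] at h
  have e1 : (1 - σ * a / K) / (σ * a / K) = (K : ℝ) / (σ * a) - 1 := by field_simp
  rw [e1] at h
  exact h

/-- **THE SAME FOR THE STEP CHAIN'S OWN STATIONARY LAW `π_S`, UNCONDITIONALLY IN THE CHAIN:** `π_S(x) ∝ g(comp x)·N(hub x)/W(hub x)` (X5) is stationary, the chain is irreducible
(X7) and aperiodic, so for every content `u`, every `a ∈ (0,1]` with `acc(·,u) ≤ a` off `u` and every `e ≥ E_{π_S}N(u)` (`0 < σ < 1`, `K ≥ 2`):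
**`t_mix^{steps}(1/4) ≥ (K/(σa) − 1)·log(K/(3(e+2)))`**. [ours] -/
theorem lumpedStar_step_mixingTime_ge_collector_piS [Nonempty X] (hinj : ∀ x x', hub x = hub x' → comp x = comp x' → x = x')
    (hsurj : ∀ (z : S) (N : S → ℕ), ∑ v, N v = K + 1 → N z ≠ 0 → ∃ x, hub x = z ∧ comp x = N) (hhub : ∀ x, comp x (hub x) ≠ 0)
    (hsum : ∀ x, ∑ v, comp x v = K + 1) (hK : 2 ≤ K) (hW : ∀ v, 0 < W v) (hacc : ∀ h v, acc h v = min 1 (W h / W v)) (hμ1 : ∑ v, μ0 v = 1) (hμpos : ∀ v, 0 < μ0 v)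
    (hσ0 : 0 < σ) (hσ1 : σ < 1)
    (hKoff : ∀ N h v, h ≠ v → Kh N h v = if N h = 0 then 0 else (N v : ℝ) / K * acc h v) (hKdiag : ∀ N h, Kh N h h = 1 - ∑ v ∈ univ.erase h, Kh N h v)
    (hA : ∀ x x', Ast x x' = if comp x' = comp x then Kh (comp x) (hub x) (hub x') else 0)
    (hB : ∀ x x', Bst x x' = μ0 (hub x') * (if comp x' + Pi.single (hub x) 1 = comp x + Pi.single (hub x') 1 then 1 else 0))
    (hS : ∀ x x', Sst x x' = σ * Ast x x' + (1 - σ) * Bst x x')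
    (hg : ∀ N, g N = ∏ v, (μ0 v * W v) ^ (N v) / ((N v).factorial : ℝ))
    (hZ : Z = ∑ x, g (comp x) * ((comp x (hub x) : ℝ) / W (hub x))) (hπS : ∀ x, πS x = g (comp x) * ((comp x (hub x) : ℝ) / W (hub x)) / Z)
    (u : S) {a : ℝ} (ha0 : 0 < a) (ha1 : a ≤ 1) (ha : ∀ h, h ≠ u → acc h u ≤ a) {e : ℝ} (he : ∑ x, πS x * (comp x u : ℝ) ≤ e) :
    ((K : ℝ) / (σ * a) - 1) * Real.log ((K : ℝ) / (3 * (e + 2))) ≤ (mixingTime Sst πS (1 / 4) : ℝ) := by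
  classical
  have hK1 : 1 ≤ K := by omega
  have hμ0 : ∀ v, 0 ≤ μ0 v := fun v => (hμpos v).le
  have hπ := lumpedStar_piS_pos hhub hW hμpos hg hZ hπS
  have hπ1 := lumpedStar_piS_sum hhub hW hμpos hg hZ hπS
  have hA0 : ∀ x x', 0 ≤ Ast x x' := starStep_swap_nonneg hW hacc hK1 hsum hKoff hKdiag hA
  have hA1 : ∀ x, ∑ x', Ast x x' = 1 := starStep_swap_rowsum hinj hsurj hhub hsum hKoff hKdiag hA
  have hB0 : ∀ x x', 0 ≤ Bst x x' := fun x x' => by rw [hB]; exact mul_nonneg (hμ0 _) (by split_ifs <;> norm_num)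
  have hB1 : ∀ x, ∑ x', Bst x x' = 1 := starStep_redraw_rowsum hinj hsurj hhub hsum hμ1 hB
  have hArev : ∀ x x', πS x * Ast x x' = πS x' * Ast x' x := starStep_swap_reversible hinj hhub hW hacc hKoff hA hπS
  have hBrev : ∀ x x', πS x * Bst x x' = πS x' * Bst x' x := starStep_redraw_reversible hhub hW hg hπS hB
  have hSrs : IsRowStochastic Sst := by
    refine ⟨fun x y => by rw [hS]; exact add_nonneg (mul_nonneg hσ0.le (hA0 x y)) (mul_nonneg (by linarith) (hB0 x y)), fun x => ?_⟩
    simp_rw [hS]; rw [sum_add_distrib, ← mul_sum, ← mul_sum, hA1, hB1]; ring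
  have hst : IsStationary πS Sst := by
    intro y
    calc ∑ x, πS x * Sst x y = ∑ x, (σ * (πS y * Ast y x) + (1 - σ) * (πS y * Bst y x)) :=
          sum_congr rfl fun x _ => by rw [hS, ← hArev, ← hBrev]; ring
      _ = σ * (πS y * ∑ x, Ast y x) + (1 - σ) * (πS y * ∑ x, Bst y x) := by rw [sum_add_distrib, ← mul_sum, ← mul_sum, ← mul_sum, ← mul_sum]
      _ = πS y := by rw [hA1, hB1]; ring
  -- `¼`-close at some time: irreducible (X7) and aperiodic (`S(x,x) > 0`), LPW Thm 4.9
  have hirr := lumpedStar_step_irreducible hsurj hhub hW hacc hK1 hsum hKoff hKdiag hμpos hσ0 hσ1 hA hB hS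
  have hap : IsAperiodic Sst := isAperiodic_of_diag_pos fun x => by
    rw [hS]
    have hBxx : Bst x x = μ0 (hub x) := by rw [hB, if_pos rfl, mul_one]
    have : 0 < (1 - σ) * Bst x x := by rw [hBxx]; exact mul_pos (by linarith) (hμpos _)
    have := mul_nonneg hσ0.le (hA0 x x)
    linarith
  have hmix : ∃ t₀, worstTvDist Sst πS t₀ ≤ 1 / 4 := exists_worstTvDist_le hSrs hirr hap hst (fun x => (hπ x).le) hπ1 (by norm_num)
  exact lumpedStar_step_mixingTime_ge_collector hinj hsurj hhub hsum hK hKoff hμ0 hσ0 hσ1.le hA hA0 hA1 hB hB1 hS (fun x => (hπ x).le) hπ1 hst u ha0 ha1 ha he hmix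

end CollectorFloor

end Summit.Ventures.LatticeQCDFlow.Scaling

end
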